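import Summits.CriticalPhenomena.CardyFormulaZ2.Theorems.CardyComplexConeParafermionToSLESixFamiliesDiamondIdentifyLimit
import Summits.CriticalPhenomena.CardyFormulaZ2.Theorems.CardyComplexConeParafermionToSLESixFamiliesDiamondIdentifyTrace
import Summits.CriticalPhenomena.CardyFormulaZ2.Theorems.CardyComplexConeParafermionToSLESixFamiliesDiamondIdentifyChain
import Summits.CriticalPhenomena.CardyFormulaZ2.Theorems.CardyComplexConeParafermionToSLESixFamiliesDiamondIdentifyPolygon
import Summits.CriticalPhenomena.CardyFormulaZ2.Theorems.CardyComplexConeParafermionToSLESixFamiliesDiamondIdentifyConformal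
import HarnessLib

/-!
# Line `potential-darboux-picard-diamond`, stub S4′ (`stub_identifyPotentialPh`): the assembly, modulo the identification of `(G′)³` with `c·ψ′/ψ`

Helper file of the stub `stub_identifyPotentialPh` of crux `ParafermionToSLESixFamilies` (stmt-CriticalPhenomena-11389).
This file assembles S1′ (`ExactPotentialTracePh`), S2 (`DarbouxPicardConvex ∧ TraceWindingNonneg`) and S3
(`ClosedPrecompactness`) into `PotentialConformalLimit` along the landed chain of helper files — Arzelà–Ascoli on the
closed diamond (`exists_subseq_potentialLimit`), DIR in the limit (`trace_sub_mem_ray`), the free side of positive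
length (`re_trace_ge_of_low`), the boundary chain of the diamond (`exists_boundaryChain`), the limit polygon
(`boundaryTrace_polygon`) and the univalence step (`conformal_of_boundaryTrace`) — MODULO the last step (v) of the
engine, the identification `(G′)³ = c·ψ′/ψ` of a conformal map of the diamond onto the interior of the limit polygon
whose boundary pieces follow the TURN rule; that statement enters `potentialConformalLimit_of_identify` (registered
helper of the crux item) as its explicit first hypothesis, written out in full (no definition is introduced). Proving
that hypothesis closes the stub verbatim.
-/

noncomputable section

namespace Summit.CriticalPhenomena.CardyFormulaZ2.Cruxes.ParafermionToSLESixFamilies.PotentialDarbouxPicardDiamond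

open scoped Topology ComplexConjugate BigOperators
open Filter Set Metric Complex
open UpperHalfPlane (upperHalfPlaneSet)
open Literature.Probability Literature.Probability.LatticeModels Literature.Probability.Percolation
open Literature.Probability.RandomPlanarGeometry
open Summit.CriticalPhenomena.CardyFormulaZ2.Cruxes.ParafermionToSLESixFamilies.IicTraceFluxPairing (IsFamily)

/-- A point of a piece of the boundary chain, its membership in the segment and its coordinate along it. -/
theorem piece_point {ℓ : ℝ → ℂ} {t : ℕ → ℝ} (htlt : ∀ j, t j < t (j + 1))
    (haff : ∀ (j : ℕ) (s : ℝ), t j ≤ s → s ≤ t (j + 1) →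
      ℓ s = ℓ (t j) + (((s - t j) / (t (j + 1) - t j) : ℝ) : ℂ) * (ℓ (t (j + 1)) - ℓ (t j)))
    (hne : ∀ j, ℓ (t j) ≠ ℓ (t (j + 1))) {j : ℕ} {s : ℝ} (hs1 : t j ≤ s) (hs2 : s ≤ t (j + 1)) :
    ℓ s ∈ segment ℝ (ℓ (t j)) (ℓ (t (j + 1))) ∧
      proj (ℓ (t j)) (ℓ (t (j + 1))) (ℓ s) = (s - t j) / (t (j + 1) - t j) * ‖ℓ (t (j + 1)) - ℓ (t j)‖ := by
  have hΔ : 0 < t (j + 1) - t j := by linarith [htlt j]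
  have hr0 : 0 ≤ (s - t j) / (t (j + 1) - t j) := div_nonneg (by linarith) hΔ.le
  have hr1 : (s - t j) / (t (j + 1) - t j) ≤ 1 := by rw [div_le_one hΔ]; linarith
  have hℓs := haff j s hs1 hs2
  constructor
  · rw [segment_eq_image' ℝ]
    refine ⟨(s - t j) / (t (j + 1) - t j), ⟨hr0, hr1⟩, ?_⟩
    show ℓ (t j) + ((s - t j) / (t (j + 1) - t j)) • (ℓ (t (j + 1)) - ℓ (t j)) = ℓ s
    rw [hℓs, real_smul]
  · have hL : (0:ℝ) < ‖ℓ (t (j + 1)) - ℓ (t j)‖ := norm_pos_iff.2 (sub_ne_zero.2 (hne j).symm)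
    have hLc : (‖ℓ (t (j + 1)) - ℓ (t j)‖ : ℂ) ≠ 0 := by exact_mod_cast hL.ne'
    have : ℓ s = ℓ (t j) + (((s - t j) / (t (j + 1) - t j) * ‖ℓ (t (j + 1)) - ℓ (t j)‖ : ℝ) : ℂ) *
        ((ℓ (t (j + 1)) - ℓ (t j)) / (‖ℓ (t (j + 1)) - ℓ (t j)‖ : ℂ)) := by
      rw [hℓs, ofReal_mul, mul_assoc, mul_div_cancel₀ _ hLc]
    rw [this, proj_param (hne j)]

/-- **The stub modulo step (v).** If every conformal map of a marked diamond onto the interior of a compact convex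
polygon, continuous up to the boundary and following the TURN rule of `ExactPotentialTracePh` along the pieces of the
boundary chain, satisfies `(G′)³ = c·ψ′/ψ` for one complex `c ≠ 0` and every chordal uniformizer `ψ = φ⁻¹`, then S1′,
S2 and S3 imply `PotentialConformalLimit`. -/
theorem potentialConformalLimit_of_identify : (∀ (D : DobrushinDomain), IsMarkedDiamond D → ∀ (N : ℕ) (ℓ : ℝ → ℂ) (t : ℕ → ℝ) (G : ℂ → ℂ) (d : ℕ → ℂ) (K : Set ℂ), 0 < N → Continuous ℓ → (∀ s : ℝ, ℓ (s + 2 * Real.pi) = ℓ s) → Set.range ℓ = frontier D.carrier → Set.InjOn ℓ (Set.Ico 0 (2 * Real.pi)) → t 0 = 0 → (∀ j, t j < t (j + 1)) → (∀ j, t (j + N) = t j + 2 * Real.pi) → (∀ j, IsBdrySegment D (ℓ (t j)) (ℓ (t (j + 1)))) → (∀ (j : ℕ) (s : ℝ), t j ≤ s → s ≤ t (j + 1) → ℓ s = ℓ (t j) + (((s - t j) / (t (j + 1) - t j) : ℝ) : ℂ) * (ℓ (t (j + 1)) - ℓ (t j))) → ‖d 0‖ = 1 → (∀ j, d (j + 1)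 = d j * Complex.exp ((((2 / 3 : ℝ) * ((ℓ (t (j + 2)) - ℓ (t (j + 1))) / (ℓ (t (j + 1)) - ℓ (t j))).arg + Real.pi / 3 * markInd D (ℓ (t (j + 1)))) : ℝ) * Complex.I)) → (∀ j, ((ℓ (t (j + 2)) - ℓ (t (j + 1))) / (ℓ (t (j + 1)) - ℓ (t j))).arg = 0 ∨ ((ℓ (t (j + 2)) - ℓ (t (j + 1))) / (ℓ (t (j + 1)) - ℓ (t j))).arg = Real.pi / 2) → ∑ j ∈ Finset.range N, ((ℓ (t (j + 2)) - ℓ (t (j + 1))) / (ℓ (t (j + 1)) - ℓ (t j))).arg = 2 * Real.pi → (∀ j, (2 / 3 : ℝ) * ((ℓ (t (j + 2)) - ℓ (t (j + 1))) / (ℓ (t (j + 1)) - ℓ (t j))).arg + Real.pi / 3 * markInd D (ℓ (t (j + 1))) = Real.pi / 3 ∨ (2 / 3 : ℝ) * ((ℓ (t (j + 2)) - ℓ (t (j + 1))) / (ℓ (t (j + 1)) - ℓ (t j))).arg + Real.pi / 3 * markInd D (ℓ (t (j + 1))) = 2 * Real.pi / 3) → ∑ j ∈ Finset.range N, ((2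 / 3 : ℝ) * ((ℓ (t (j + 2)) - ℓ (t (j + 1))) / (ℓ (t (j + 1)) - ℓ (t j))).arg + Real.pi / 3 * markInd D (ℓ (t (j + 1)))) = 2 * Real.pi → ContinuousOn G (closure D.carrier) → DifferentiableOn ℂ G D.carrier → Set.InjOn G D.carrier → K = convexHull ℝ (Set.range fun j => G (ℓ (t j))) → IsCompact K → Convex ℝ K → (interior K).Nonempty → G '' D.carrier = interior K → (∀ z ∈ frontier D.carrier, G z ∈ frontier K) → (∀ (j : ℕ) (s s' : ℝ), t j ≤ s → s ≤ s' → s' ≤ t (j + 1) → ∃ r : ℝ, 0 ≤ r ∧ G (ℓ s') - G (ℓ s) = r * d j) → ∃ cst : ℂ, cst ≠ 0 ∧ ∀ φ : ConformalEquiv upperHalfPlaneSet D.carrier, D.IsChordalUniformizing φ → ∀ w ∈ D.carrier, deriv G w ^ 3 = cst * (deriv (fun x : ℂ => φ.symm x) w / φ.symm w)) → ExactPotentialTracePh → (DarbouxPicardConvex ∧ TraceWindingNonneg) → ClosedPrecompactness → PotentialConformalLimit := by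
  intro hIdent hS1 hS2 hS3 D hD Λ hΛ u hu hu0
  obtain ⟨hDP, hTW⟩ := hS2
  obtain ⟨hE, τ, uA, C, c₁, hc₁, huA, hτ1, hTURN, hDIR, hLOW⟩ := hS1 D hD Λ hΛ
  obtain ⟨hequi, hclass, p, q, c₀, hpq, hfree, hc₀, hmass⟩ := hS3 D hD Λ hΛ
  refine ⟨eventually_atTop_of_eventually_nhdsGT hu hu0 hE, ?_⟩
  -- Step (i): the subsequential limit on the closed diamond
  obtain ⟨s, P, zc, alim, G, hs, hP, halim1, halim, hGc, hunif, hPL, hall⟩ :=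
    exists_subseq_potentialLimit D hD Λ hΛ hE hequi u hu hu0 (fun k => uA (u k)) fun k => huA _
  set u' : ℕ → ℝ := fun k => u (s k) with hu'
  have hu'pos : ∀ k, 0 < u' k := fun k => hu _
  have hu'0 : Tendsto u' atTop (𝓝 0) := hu0.comp hs.tendsto_atTop
  have ha' : ∀ k, ‖uA (u' k)‖ = 1 := fun k => huA _
  have hGclass : DifferentiableOn ℂ G D.carrier ∨ DifferentiableOn ℂ (fun z => conj (G z)) D.carrier :=
    hclass u' hu'pos hu'0 G hPL
  -- Step (ii′): DIR in the limit on every oriented boundary segment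
  have htrace : ∀ p q : ℂ, IsBdrySegment D p q → ∀ z ∈ segment ℝ p q, ∀ z' ∈ segment ℝ p q,
      proj p q z ≤ proj p q z' → ∃ r : ℝ, 0 ≤ r ∧ G z' - G z = r * (alim * τ p q) := fun p q hpq =>
    trace_sub_mem_ray D hD Λ hΛ (τ p q) uA C p q hpq (hDIR p q hpq) u' hu'pos hu'0 ha' P zc alim G hP halim hGc hunif
  -- Step (iii): the boundary chain and the directions
  obtain ⟨N, ℓ, t, c, hN4, hc, hconvD, hℓc, hper, hrange, hinj, ht0, htlt, htper, hseg, haff, harg, hargsum, hθcases,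
    hθsum⟩ := exists_boundaryChain D hD
  have hN : 0 < N := by omega
  set θ : ℕ → ℝ := fun j => (2 / 3 : ℝ) * ((ℓ (t (j + 2)) - ℓ (t (j + 1))) / (ℓ (t (j + 1)) - ℓ (t j))).arg +
    Real.pi / 3 * markInd D (ℓ (t (j + 1))) with hθdef
  set d : ℕ → ℂ := fun j => alim * τ (ℓ (t j)) (ℓ (t (j + 1))) with hddef
  have hd : ∀ j, d (j + 1) = d j * exp (θ j * I) := by
    intro j
    simp only [hddef, hθdef]
    rw [show j + 1 + 1 = j + 2 by ring, hTURN _ _ _ (hseg j) (by rw [show j + 2 = j + 1 + 1 by ring]; exact hseg (j + 1)),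
      mul_assoc]
  have hd0 : ‖d 0‖ = 1 := by simp only [hddef]; rw [norm_mul, halim1, hτ1 _ _ (hseg 0), one_mul]
  have hd0ne : d 0 ≠ 0 := fun h => by rw [h, norm_zero] at hd0; exact zero_ne_one hd0
  have hπ := Real.pi_pos
  have hθ : ∀ j, 0 < θ j ∧ θ j < Real.pi := by
    intro j
    rcases hθcases j with h | h
    · have : θ j = Real.pi / 3 := h
      rw [this]; constructor <;> linarith
    · have : θ j = 2 * Real.pi / 3 := h
      rw [this]; constructor <;> linarith
  have hvper : ∀ j, ℓ (t (j + N)) = ℓ (t j) := fun j => by rw [htper, hper]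
  have hθper : ∀ j, θ (j + N) = θ j := by
    intro j
    simp only [hθdef]
    rw [show j + N + 2 = (j + 2) + N by ring, show j + N + 1 = (j + 1) + N by ring, hvper, hvper, hvper]
  have hθsum' : ∑ j ∈ Finset.range N, θ j = 2 * Real.pi := hθsum
  -- monotonicity of `G` along `d j` on piece `j`
  have hne : ∀ j, ℓ (t j) ≠ ℓ (t (j + 1)) := fun j => (hseg j).1
  have hmono : ∀ (j : ℕ) (s s' : ℝ), t j ≤ s → s ≤ s' → s' ≤ t (j + 1) →
      ∃ r : ℝ, 0 ≤ r ∧ G (ℓ s') - G (ℓ s) = r * d j := by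
    intro j s s' h1 h2 h3
    obtain ⟨hz, hprz⟩ := piece_point htlt haff hne h1 (h2.trans h3)
    obtain ⟨hz', hprz'⟩ := piece_point htlt haff hne (h1.trans h2) h3
    have hΔ : 0 < t (j + 1) - t j := by linarith [htlt j]
    refine htrace _ _ (hseg j) _ hz _ hz' ?_
    rw [hprz, hprz']
    exact mul_le_mul_of_nonneg_right (div_le_div_of_nonneg_right (by linarith) hΔ.le) (norm_nonneg _)
  -- the limit polygon
  obtain ⟨hKc, hKconv, hKfr, hstrict, hdeg⟩ := boundaryTrace_polygon D N ℓ t G d θ hN hper hrange ht0 htlt htper hd0ne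
    hd (fun j => ⟨(hθ j).1.le, (hθ j).2.le⟩) hθper hθsum' hmono
  set K := convexHull ℝ (Set.range fun j => G (ℓ (t j))) with hK
  -- the free side of positive length: `G` is not constant on the closed diamond
  have hlow := re_trace_ge_of_low D hD Λ hΛ (τ p q) uA C c₁ c₀ p q hpq hc₁.le (hLOW p q hpq hfree) hmass u' hu'pos hu'0 P
    zc alim G hP halim hGc hunif
  set w : ℂ := p + ((1 / 8 : ℝ) : ℂ) * (q - p) with hw
  set w' : ℂ := p + ((7 / 8 : ℝ) : ℂ) * (q - p) with hw'
  have hwmem : ∀ r : ℝ, 0 ≤ r → r ≤ 1 → p + (r : ℂ) * (q - p) ∈ closure D.carrier := fun r hr0 hr1 =>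
    frontier_subset_closure (hpq.2.1 (by
      rw [segment_eq_image' ℝ]; exact ⟨r, ⟨hr0, hr1⟩, by show p + r • (q - p) = _; rw [real_smul]⟩))
  have hGne : G w' ≠ G w := by
    intro heq
    have : c₁ * c₀ ≤ 0 := by simpa [heq] using hlow
    nlinarith
  have hint : (interior K).Nonempty := by
    by_contra hempty
    rw [Set.not_nonempty_iff_eq_empty] at hempty
    exact hGne (hdeg hempty hGc hGclass w' (hwmem _ (by norm_num) (by norm_num)) w (hwmem _ (by norm_num) (by norm_num)))
  obtain ⟨w₀, hw₀⟩ := hint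
  -- Step (iv): univalence onto `interior K`
  obtain ⟨hGhol, hGinj, hGim⟩ := conformal_of_boundaryTrace hDP hTW D N ℓ t c w₀ G d θ K hN hc hconvD hℓc hper hrange
    hinj ht0 htlt htper hseg haff harg hargsum hGc hGclass hd0ne hd (fun j => ⟨(hθ j).1.le, (hθ j).2⟩) hθsum' hmono hKc
    hKconv hw₀ (fun z hz => (hKfr z hz).2) (hstrict w₀ hw₀)
  -- Step (v): the identification (hypothesis)
  obtain ⟨cst, hcst, hident⟩ := hIdent D hD N ℓ t G d K hN hℓc hper hrange hinj ht0 htlt htper hseg haff hd0 hd harg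
    hargsum hθcases hθsum hGc hGhol hGinj hK hKc hKconv ⟨w₀, hw₀⟩ hGim (fun z hz => (hKfr z hz).2) hmono
  exact ⟨s, cst, G, hs, hcst, hGhol, hGc, hident, hall⟩

end Summit.CriticalPhenomena.CardyFormulaZ2.Cruxes.ParafermionToSLESixFamilies.PotentialDarbouxPicardDiamond

end
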